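import Mathlib
import Summits.SmoothPoincare4.SmoothPoincare4.Theses.SullivanDual
import Literature.Geometry.Symplectic.TamingWitness

/-!
# Sketch — crux-ideate stmt-SmoothPoincare4-7823 (decl `Target`, route SullivanDual), ideator 1

First lemmas of the two idea cards (signatures over existing declarations; the two
"entry" lemmas are proved here to certify they are real):

* `noWitness_of_tamed` / `target_of_tamingForm` — the trivial direction of the relative
  Sullivan duality: a closed form standard on the ball and taming `J` off it kills every
  witness; hence a single closed form standard on `B_{ε₁}` taming `J` everywhere gives `Target`.
  (Entry point of card `harmonic-sd-last-circle`: the form is the asymptotically standard closed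
  self-dual form of a zero-free conformal class, normalised on a shell.)
* `jacket_liouville` — card `kahler-jacket`: if `F : Σ∖p → ℝ⁴` is `(J, i)`-holomorphic and
  immersive along a `J`-holomorphic entire curve `u` with `F ∘ u` bounded, then `u` is constant
  (Liouville); i.e. for the jacket structure `J_F` every Brody curve must enter the small ball
  where `F` fails to be `J`-holomorphic.
* `jacketImmersion_exists` — card `kahler-jacket`, construction statement (Smale–Hirsch–Phillips
  h-principle): `Σ ∖ {p, q}` immerses in `ℝ⁴` agreeing with the inverted chart near `p`.
-/

noncomputable section

open scoped Manifold ContDiff Topology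
open Set Function Literature.Geometry.Kaehler Literature.Geometry.Symplectic

set_option linter.dupNamespace false

namespace Summit.SmoothPoincare4.SmoothPoincare4.Cruxes.Target.Ideator1

local notation "E4" => EuclideanSpace ℝ (Fin 4)

variable {M : Type*} [TopologicalSpace M] [ChartedSpace E4 M] [T1Space M]

/-- Trivial direction of relative Sullivan duality: a smooth closed form, standard on the
punctured `ε`-ball and taming `J` off it, excludes every taming witness at radius `ε`. -/
theorem noWitness_of_tamed (p : M) (ε : ℝ)
    (J : ∀ x : punctured p, TangentSpace (𝓡 4) x →L[ℝ] TangentSpace (𝓡 4) x)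
    (sf : MForm (𝓡 4) (punctured p) ℝ 2) (hs : IsSmoothForm sf) (hc : IsClosedForm sf)
    (hstd : IsStandardOnBall p ε sf) (ht : TamesOffBall p ε J sf) : NoWitness p ε J := by
  intro T hT
  have h1 : 0 < T sf := hT.pos_of_tames hs ht
  have h2 : T sf ≤ 0 := hT.nonpos_of_standard hs hc hstd
  exact absurd h2 (not_le.mpr h1)

/-- `Target` from ONE closed form per `(Σ, p)`: if every punctured homotopy 4-sphere carries a
smooth `J` with `J² = −1` and a smooth closed 2-form which is standard on some punctured
`ε₁`-ball and tames `J` everywhere, then `Target` holds (monotonicity of "standard on the ball"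
in the radius). Entry lemma of card `harmonic-sd-last-circle`. -/
theorem target_of_tamingForm
    (h : ∀ (S : Literature.Topology.FourManifolds.HomotopySphere 4) (p : S.carrier),
      ∃ (J : ∀ x : punctured p, TangentSpace (𝓡 4) x →L[ℝ] TangentSpace (𝓡 4) x),
        (∀ (x : punctured p) (v : TangentSpace (𝓡 4) x), J x (J x v) = -v) ∧
        (∀ x₀ : punctured p, ContMDiffAt (𝓡 4) 𝓘(ℝ, E4 →L[ℝ] E4) ∞
          (inTangentCoordinates (𝓡 4) (𝓡 4) (id : punctured p → punctured p) id
            (fun x => J x) x₀) x₀) ∧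
        ∃ ε₁ : ℝ, 0 < ε₁ ∧ ∃ sf : MForm (𝓡 4) (punctured p) ℝ 2,
          IsSmoothForm sf ∧ IsClosedForm sf ∧ IsStandardOnBall p ε₁ sf ∧
          ∀ (x : punctured p) (v : TangentSpace (𝓡 4) x), v ≠ 0 → 0 < sf x ![v, J x v]) :
    Summit.SmoothPoincare4.SmoothPoincare4.Theses.SullivanDual.Target := by
  intro S p
  obtain ⟨J, hJ2, hJs, ε₁, hε₁, sf, hs, hc, hstd, ht⟩ := h S p
  refine ⟨J, hJ2, hJs, ε₁, hε₁, fun ε hε hle => ?_⟩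
  have key : NoWitness p ε J :=
    noWitness_of_tamed p ε J sf hs hc (hstd.anti hle) (fun x _ v hv => ht x v hv)
  exact (noWitness_iff.mp key)

/-- Card `kahler-jacket`, first checkable lemma (Liouville localisation of Brody curves).
`F : Σ∖p → ℝ⁴` is `(J, i)`-holomorphic at the points of an entire `J`-curve `u`
(`⟪dF(J v), b⟫ = ω₀(dF v, b)`, the tree's way of writing `dF ∘ J = i ∘ dF`), immersive there,
and `F ∘ u` is bounded: then `u` is constant. Proof route: `F ∘ u : ℂ → ℝ⁴ ≅ ℂ²` is
holomorphic and bounded, hence constant (Liouville), and `dF` injective forces `du = 0`. -/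
def JacketLiouville : Prop :=
  ∀ (S : Literature.Topology.FourManifolds.HomotopySphere 4) (p : S.carrier)
    (J : ∀ x : punctured p, TangentSpace (𝓡 4) x →L[ℝ] TangentSpace (𝓡 4) x)
    (F : punctured p → E4) (u : ℂ → punctured p),
    ContMDiff 𝓘(ℝ, ℂ) (𝓡 4) ∞ u →
    (∀ z ζ : ℂ, mfderiv 𝓘(ℝ, ℂ) (𝓡 4) u z (Complex.I * ζ : ℂ) =
      J (u z) (mfderiv 𝓘(ℝ, ℂ) (𝓡 4) u z (ζ : ℂ))) →
    (∀ z : ℂ, ContMDiffAt (𝓡 4) 𝓘(ℝ, E4) ∞ F (u z) ∧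
      Injective (mfderiv (𝓡 4) 𝓘(ℝ, E4) F (u z)) ∧
      ∀ (v : TangentSpace (𝓡 4) (u z)) (b : E4),
        inner ℝ (@id E4 (mfderiv (𝓡 4) 𝓘(ℝ, E4) F (u z) (J (u z) v))) b =
          stdSymplecticForm (@id E4 (mfderiv (𝓡 4) 𝓘(ℝ, E4) F (u z) v)) b) →
    (∃ C : ℝ, ∀ z : ℂ, ‖F (u z)‖ ≤ C) →
    ∀ z z' : ℂ, u z = u z'

/-- Card `kahler-jacket`, construction statement (Smale–Hirsch–Phillips h-principle for
immersions of the open manifold `Σ ∖ {p, q}` relative to the `p`-end): there is a map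
`F : Σ∖p → ℝ⁴`, smooth and immersive away from `q`, agreeing with the inverted recentred chart
`ι ∘ (e − e p)` near `p`. (Formal data exist and are unique: `(Σ∖{p,q}, end at p)` is an acyclic
pair; the free end at `q` makes the relative h-principle applicable.) -/
def JacketImmersionExists : Prop :=
  ∀ (S : Literature.Topology.FourManifolds.HomotopySphere 4) (p q : S.carrier), q ≠ p →
    ∃ F : punctured p → E4,
      (∀ x : punctured p, x.1 ≠ q →
        ContMDiffAt (𝓡 4) 𝓘(ℝ, E4) ∞ F x ∧ Injective (mfderiv (𝓡 4) 𝓘(ℝ, E4) F x)) ∧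
      AgreesWithInvertedChartNear p F

end Summit.SmoothPoincare4.SmoothPoincare4.Cruxes.Target.Ideator1
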